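/-
Copyright (c) 2026 the pub-hodgecm-mathlib formalisation cell (harness21).  Prover seat hodgecm-mathlib-K2E3-p11 (g5), Track B «K2-LIT» ∕ h413
(`stmt-HodgeConjecture-24833`), line `K2_E3_EllipticInputs`, unit U12 §L, Richardson road for (LBGL-ge3) at `N = 3` (road owner K2E3-p11), brick (F-E) =
(LBGL-3E) «THE (2,1)-PARABOLIC SLICE DENSITY OF 𝔤𝔩₃(F)», FILE H″6a «TRANSPORT OF A LOCAL DENSITY TO A CONJUGATE POINT».  2026-09-04.
-/
import Summits.HodgeConjecture.HodgeConjecture.Theorems.K2E3GL3ParabolicSliceTwistForm    -- ★ A′2 (K2E3-p21 g4): `lintegral_glInt_pi_conj_parabolic_conj_eq` (Ad(G)-invariance of the slice)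
import Summits.HodgeConjecture.HodgeConjecture.Theorems.K2E3GL3LieAdInvariant            -- ★ I (K2E3-p17 g6): `lintegral_comp_conj_eq` (Ad(g) preserves `μ𝔤`, all `g ∈ GL₃(F)`)
import Summits.HodgeConjecture.HodgeConjecture.Theorems.K2E3GLnLieAdIntegralInvariant      -- ★ (K2E3-p12): `continuous_conj`
import Summits.HodgeConjecture.HodgeConjecture.Theorems.K2E3GLnMaximalParabolicDescent      -- ★ K1: matrix LCS ∕ 2nd countability
import Literature.NumberTheory.GaloisRepresentations.LocalFieldFiniteExtension              -- ★ R1 frame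
import Literature.NumberTheory.Automorphic.LocalFieldHaarBalls                              -- ★ `primePowBall` kit, `exists_normAbs_eq_inv`
import Literature.MeasureTheory.Group.LocalFieldGLnVolume                                  -- ★ boxes `M₃(𝔭^k)` open
import HarnessLib

/-!
# K2_E3 road (h413), §L ∕ Richardson road at `N = 3`, brick (F-E) FILE H″6a: transport of a local density to a conjugate point

Cell `pub/hodgecm-mathlib` (D-0151), Track B, seat K2E3-p11 (g5) (road owner of (F-E) = (LBGL-3E) `sig_K2E3GL3ParabolicSliceDensity`; ROAD v2 on `K2/STATUS.md`,
2026-09-04).  `--supports stmt-HodgeConjecture-24833 --as helper`; THEOREMS ONLY (no definition ∕ instance ∕ notation ∕ named fact ∕ `sorry`); never imports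
`Cruxes/…/Lines`.  COUNT-NEUTRAL.

THE POINT.  The (2,1)-parabolic slice functional `ρ(φ) = ∫⁻_K ∫⁻_{F⁷} φ(k·P(r)·k⁻¹) dr dκ` is `Ad(GL₃(F))`-invariant (★ A′2) and so is `μ𝔤` (★ I).  Hence a LOCAL DENSITY
`ρ(1_{B_J(M₀)}·h) = e · ∫⁻_{B_J(M₀)} h dμ𝔤` on all deep balls `B_J(M₀) = M₀ + M₃(𝔭^J)` (★ H″2 at an elliptic Levi point, ★ H″3b at a split regular point) TRANSPORTS to
every conjugate `X₀ = g M₀ g⁻¹`: inside any neighbourhood `N` of `X₀` there is an open `V ∋ X₀` (`V = Ad(g) B_J(M₀)`) with `ρ(1_V·h) = e · ∫⁻_V h dμ𝔤` for all measurable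
`h ≥ 0`.  The balls `B_J(M₀)` form a neighbourhood basis of `M₀` (valuation sup norm), which lets `V` be taken inside the neighbourhood where the density `w` of the
leaf is constant (★ R′).
* `exists_ball_subset_of_mem_nhds` (ball basis);  **`exists_open_local_density_conj`** (the transport).
[HarishChandra1999AdmissibleDistributions, §7 Lemma 7.8] [HarishChandra1970, Part V §4 Lemma 22]
HONEST LABEL: HC_CM is proved only modulo the 7 printed citations (2 remaining named inputs: hLiu418 = stmt-HodgeConjecture-24832, h413 = stmt-HodgeConjecture-24833)
until rung 0 closes; count-neutral helper ((LBGL-ge3)∕(LBGL-3E) NOT ★ here).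

## References
* [HarishChandra1999AdmissibleDistributions] Harish-Chandra (DeBacker–Sally), *Admissible Invariant Distributions on Reductive p-adic Groups* (1999), §7, Lemma 7.8.
* [HarishChandra1970] Harish-Chandra (van Dijk), *Harmonic Analysis on Reductive p-adic Groups*, LNM 162 (1970), Part V §4 Lemma 22.
-/

set_option autoImplicit false
set_option linter.dupNamespace false

noncomputable section

open MeasureTheory Measure Filter Topology Set Matrix
open scoped MatrixGroups NNReal ENNReal
open Literature.NumberTheory.Automorphic Literature.NumberTheory.Automorphic.LocalFieldHaar
open Literature.NumberTheory.GaloisRepresentations Literature.NumberTheory.GaloisRepresentations.IsNonarchimedeanLocalField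
open Summit.HodgeConjecture.HodgeConjecture.Cruxes.H413.K2E3GLnMaximalParabolicDescent

namespace Summit.HodgeConjecture.HodgeConjecture.Cruxes.H413.K2E3GL3ParabolicSliceLocalDensityTransport

variable {F : Type*} [Field F] [ValuativeRel F] [TopologicalSpace F] [IsNonarchimedeanLocalField F]
  [MeasurableSpace F] [BorelSpace F]
  [MeasurableSpace (Matrix (Fin 3) (Fin 3) F)] [BorelSpace (Matrix (Fin 3) (Fin 3) F)]
  [MeasurableSpace (GL (Fin 3) F)] [BorelSpace (GL (Fin 3) F)]

omit [MeasurableSpace F] [BorelSpace F] [MeasurableSpace (Matrix (Fin 3) (Fin 3) F)] [BorelSpace (Matrix (Fin 3) (Fin 3) F)]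
  [MeasurableSpace (GL (Fin 3) F)] [BorelSpace (GL (Fin 3) F)] in
/-- **The balls `M₀ + M₃(𝔭^J)` form a neighbourhood basis of `M₀`** (they are the closed balls of the valuation sup norm, radii `‖ϖ‖^J → 0`). [folklore] -/
theorem exists_ball_subset_of_mem_nhds (M₀ : Matrix (Fin 3) (Fin 3) F) {N : Set (Matrix (Fin 3) (Fin 3) F)} (hN : N ∈ 𝓝 M₀) :
    ∃ J₀ : ℕ, ∀ J : ℕ, J₀ ≤ J → {X : Matrix (Fin 3) (Fin 3) F | ∀ i l, (X - M₀) i l ∈ primePowBall F (J : ℤ)} ⊆ N := by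
  classical
  letI : NontriviallyNormedField F := IsNonarchimedeanLocalField.nontriviallyNormedField F
  letI : NormedAddCommGroup (Matrix (Fin 3) (Fin 3) F) := Matrix.normedAddCommGroup
  obtain ⟨ϖ, hϖ0, hϖ⟩ := exists_normAbs_eq_inv (F := F)
  have hγ0 : 0 < ‖ϖ‖ := norm_pos_iff.2 hϖ0
  have hγ1 : ‖ϖ‖ < 1 := by
    rw [IsNonarchimedeanLocalField.norm_lt_one_iff, ← normAbs_lt_one_iff, hϖ]
    exact inv_lt_one_of_one_lt₀ (by exact_mod_cast one_lt_residueFieldCard F)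
  obtain ⟨ε, hε, hball⟩ := Metric.nhds_basis_closedBall.mem_iff.1 hN
  obtain ⟨J₀, hJ₀⟩ := exists_pow_lt_of_lt_one hε hγ1
  refine ⟨J₀, fun J hJ X hX => hball ?_⟩
  rw [Metric.mem_closedBall, dist_eq_norm, Matrix.norm_le_iff hε.le]
  intro i l
  have h1 := hX i l
  rw [primePowBall, Set.mem_setOf_eq, ← hϖ, ← map_zpow₀, normAbs_le_normAbs_iff, ← Valuation.Compatible.vle_iff_le (v := ValuativeRel.valuation F),
    ← IsNonarchimedeanLocalField.norm_le_norm_iff_vle, zpow_natCast, norm_pow] at h1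
  exact h1.trans ((pow_le_pow_of_le_one hγ0.le hγ1.le hJ).trans hJ₀.le)

/-- **TRANSPORT OF A LOCAL DENSITY TO A CONJUGATE POINT.**  `κ` a Haar measure on `K = GL₃(𝒪)`, `dx`, `μ𝔤` additive Haar measures.  If the slice functional has
density `e` on all deep balls at `M₀` (`ρ(1_{B_J(M₀)}·h) = e · ∫⁻_{B_J(M₀)} h dμ𝔤` for `J ≥ J₀`), then for every `g ∈ GL₃(F)` and every neighbourhood `N` of
`X₀ = g M₀ g⁻¹` there is an open `V` with `X₀ ∈ V ⊆ N` and `ρ(1_V·h) = e · ∫⁻_V h dμ𝔤` for all measurable `h ≥ 0` (`V = Ad(g) B_J(M₀)`; ★ A′2 invariance of `ρ`, ★ I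
invariance of `μ𝔤`). [cite: HarishChandra1999AdmissibleDistributions, §7 Lemma 7.8] -/
theorem exists_open_local_density_conj (κ : Measure ↥(glInt 3 F)) [IsHaarMeasure κ] (dx : Measure F) [dx.IsAddHaarMeasure]
    (μ𝔤 : Measure (Matrix (Fin 3) (Fin 3) F)) [μ𝔤.IsAddHaarMeasure] (M₀ : Matrix (Fin 3) (Fin 3) F) (e : ℝ≥0∞) (J₀ : ℕ)
    (hloc : ∀ J : ℕ, J₀ ≤ J → ∀ h : Matrix (Fin 3) (Fin 3) F → ℝ≥0∞, Measurable h →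
      ∫⁻ k : ↥(glInt 3 F), ∫⁻ r : Fin 7 → F,
          ({X : Matrix (Fin 3) (Fin 3) F | ∀ i l, (X - M₀) i l ∈ primePowBall F (J : ℤ)}).indicator h
            (((k : GL (Fin 3) F) : Matrix (Fin 3) (Fin 3) F) * !![r 0, r 1, r 2; r 3, r 4, r 5; 0, 0, r 6] *
              ((((k : GL (Fin 3) F))⁻¹ : GL (Fin 3) F) : Matrix (Fin 3) (Fin 3) F))
          ∂(Measure.pi fun _ : Fin 7 => dx) ∂κ =
        e * ∫⁻ X in {X : Matrix (Fin 3) (Fin 3) F | ∀ i l, (X - M₀) i l ∈ primePowBall F (J : ℤ)}, h X ∂μ𝔤)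
    (g : GL (Fin 3) F) {N : Set (Matrix (Fin 3) (Fin 3) F)}
    (hN : N ∈ 𝓝 ((g : Matrix (Fin 3) (Fin 3) F) * M₀ * ((g⁻¹ : GL (Fin 3) F) : Matrix (Fin 3) (Fin 3) F))) :
    ∃ V : Set (Matrix (Fin 3) (Fin 3) F), IsOpen V ∧ (g : Matrix (Fin 3) (Fin 3) F) * M₀ * ((g⁻¹ : GL (Fin 3) F) : Matrix (Fin 3) (Fin 3) F) ∈ V ∧ V ⊆ N ∧
      ∀ h : Matrix (Fin 3) (Fin 3) F → ℝ≥0∞, Measurable h →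
        ∫⁻ k : ↥(glInt 3 F), ∫⁻ r : Fin 7 → F,
            V.indicator h (((k : GL (Fin 3) F) : Matrix (Fin 3) (Fin 3) F) * !![r 0, r 1, r 2; r 3, r 4, r 5; 0, 0, r 6] *
              ((((k : GL (Fin 3) F))⁻¹ : GL (Fin 3) F) : Matrix (Fin 3) (Fin 3) F)) ∂(Measure.pi fun _ : Fin 7 => dx) ∂κ =
          e * ∫⁻ X in V, h X ∂μ𝔤 := by
  classical
  haveI : T2Space F := (isLocalField F).toT2Space
  haveI : IsTopologicalRing F := inferInstance
  -- `Ad(g)`, `Ad(g⁻¹)` as mutually inverse continuous maps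
  set Adg : Matrix (Fin 3) (Fin 3) F → Matrix (Fin 3) (Fin 3) F := fun Z => (g : Matrix (Fin 3) (Fin 3) F) * Z * ((g⁻¹ : GL (Fin 3) F) : Matrix (Fin 3) (Fin 3) F)
    with hAdg
  set Adgi : Matrix (Fin 3) (Fin 3) F → Matrix (Fin 3) (Fin 3) F := fun Y => ((g⁻¹ : GL (Fin 3) F) : Matrix (Fin 3) (Fin 3) F) * Y * (g : Matrix (Fin 3) (Fin 3) F)
    with hAdgi
  have hgg : ((g⁻¹ : GL (Fin 3) F) : Matrix (Fin 3) (Fin 3) F) * (g : Matrix (Fin 3) (Fin 3) F) = 1 := by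
    rw [← Units.val_mul, inv_mul_cancel, Units.val_one]
  have hgg' : (g : Matrix (Fin 3) (Fin 3) F) * ((g⁻¹ : GL (Fin 3) F) : Matrix (Fin 3) (Fin 3) F) = 1 := by
    rw [← Units.val_mul, mul_inv_cancel, Units.val_one]
  have h1 : ∀ Z, Adgi (Adg Z) = Z := fun Z => by
    simp only [hAdg, hAdgi]
    rw [show ((g⁻¹ : GL (Fin 3) F) : Matrix (Fin 3) (Fin 3) F) * ((g : Matrix (Fin 3) (Fin 3) F) * Z * ((g⁻¹ : GL (Fin 3) F) : Matrix (Fin 3) (Fin 3) F)) *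
        (g : Matrix (Fin 3) (Fin 3) F) = (((g⁻¹ : GL (Fin 3) F) : Matrix (Fin 3) (Fin 3) F) * (g : Matrix (Fin 3) (Fin 3) F)) * Z *
        (((g⁻¹ : GL (Fin 3) F) : Matrix (Fin 3) (Fin 3) F) * (g : Matrix (Fin 3) (Fin 3) F)) by noncomm_ring, hgg, Matrix.one_mul, Matrix.mul_one]
  have h2 : ∀ Y, Adg (Adgi Y) = Y := fun Y => by
    simp only [hAdg, hAdgi]
    rw [show (g : Matrix (Fin 3) (Fin 3) F) * (((g⁻¹ : GL (Fin 3) F) : Matrix (Fin 3) (Fin 3) F) * Y * (g : Matrix (Fin 3) (Fin 3) F)) *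
        ((g⁻¹ : GL (Fin 3) F) : Matrix (Fin 3) (Fin 3) F) = ((g : Matrix (Fin 3) (Fin 3) F) * ((g⁻¹ : GL (Fin 3) F) : Matrix (Fin 3) (Fin 3) F)) * Y *
        ((g : Matrix (Fin 3) (Fin 3) F) * ((g⁻¹ : GL (Fin 3) F) : Matrix (Fin 3) (Fin 3) F)) by noncomm_ring, hgg', Matrix.one_mul, Matrix.mul_one]
  have hci : Continuous Adgi := by
    have h := K2E3GLnLieAdIntegralInvariant.continuous_conj (F := F) (N := 3) g⁻¹
    simp only [inv_inv] at h
    exact h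
  -- choose the ball inside `Ad(g)⁻¹ N`
  have hpre : {Z : Matrix (Fin 3) (Fin 3) F | Adg Z ∈ N} ∈ 𝓝 M₀ := by
    have hc : Continuous Adg := K2E3GLnLieAdIntegralInvariant.continuous_conj (F := F) (N := 3) g
    exact hc.continuousAt.preimage_mem_nhds hN
  obtain ⟨J₁, hJ₁⟩ := exists_ball_subset_of_mem_nhds M₀ hpre
  set J : ℕ := max J₀ J₁ with hJ
  set B : Set (Matrix (Fin 3) (Fin 3) F) := {X : Matrix (Fin 3) (Fin 3) F | ∀ i l, (X - M₀) i l ∈ primePowBall F (J : ℤ)} with hB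
  have hBN : ∀ Z ∈ B, Adg Z ∈ N := fun Z hZ => hJ₁ J (le_max_right _ _) hZ
  have hBopen : IsOpen B := by
    have hcont : Continuous fun X : Matrix (Fin 3) (Fin 3) F => X - M₀ := continuous_id.sub continuous_const
    have : B = (fun X : Matrix (Fin 3) (Fin 3) F => X - M₀) ⁻¹' {Y | ∀ i l, Y i l ∈ primePowBall F (J : ℤ)} := rfl
    rw [this]
    exact (Literature.MeasureTheory.Group.isOpen_setOf_forall_mem_primePowBall (F := F) (n := Fin 3) (J : ℤ)).preimage hcont
  -- `V = Ad(g) B = Ad(g⁻¹)⁻¹ B`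
  set V : Set (Matrix (Fin 3) (Fin 3) F) := Adgi ⁻¹' B with hV
  have hVB : ∀ Y, Y ∈ V ↔ Adgi Y ∈ B := fun Y => Iff.rfl
  refine ⟨V, hBopen.preimage hci, ?_, ?_, fun h hh => ?_⟩
  · -- `X₀ ∈ V`
    show Adgi (Adg M₀) ∈ B
    rw [h1]
    intro i l
    simp only [sub_self, Matrix.zero_apply]
    exact zero_mem_primePowBall _
  · -- `V ⊆ N`
    intro Y hY
    have h := hBN _ hY
    rwa [h2] at h
  · -- the density: `ρ(1_V h) = ρ((1_V h) ∘ Ad g)` (★ A′2 at `g⁻¹`) `= ρ(1_B · (h ∘ Ad g)) = e ∫⁻_B h ∘ Ad g = e ∫⁻_V h` (★ I)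
    have hφ : ∀ Z, V.indicator h (Adg Z) = B.indicator (fun Z => h (Adg Z)) Z := by
      intro Z
      have hiff : Adg Z ∈ V ↔ Z ∈ B := by rw [hVB, h1]
      by_cases hZ : Z ∈ B
      · rw [Set.indicator_of_mem (hiff.2 hZ), Set.indicator_of_mem hZ]
      · rw [Set.indicator_of_notMem (fun h' => hZ (hiff.1 h')), Set.indicator_of_notMem hZ]
    have hmeas : Measurable fun Z => h (Adg Z) := hh.comp (K2E3GLnLieAdIntegralInvariant.continuous_conj (F := F) (N := 3) g).measurable
    -- ★ A′2 with `g⁻¹`: `ρ(ψ ∘ Ad(g⁻¹)) = ρ(ψ)` for `ψ = (1_V h) ∘ Ad g`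
    have hA := K2E3GL3ParabolicSliceTwistForm.lintegral_glInt_pi_conj_parabolic_conj_eq κ dx g⁻¹ (fun Z => V.indicator h (Adg Z))
      ((hh.indicator (hBopen.preimage hci).measurableSet).comp (K2E3GLnLieAdIntegralInvariant.continuous_conj (F := F) (N := 3) g).measurable)
    simp only [inv_inv] at hA
    -- LHS of the goal = LHS of `hA` (since `Ad g (Ad g⁻¹ Y) = Y`)
    have hL : ∀ Y : Matrix (Fin 3) (Fin 3) F, V.indicator h Y = V.indicator h (Adg (Adgi Y)) := fun Y => by rw [h2]
    calc ∫⁻ k : ↥(glInt 3 F), ∫⁻ r : Fin 7 → F,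
            V.indicator h (((k : GL (Fin 3) F) : Matrix (Fin 3) (Fin 3) F) * !![r 0, r 1, r 2; r 3, r 4, r 5; 0, 0, r 6] *
              ((((k : GL (Fin 3) F))⁻¹ : GL (Fin 3) F) : Matrix (Fin 3) (Fin 3) F)) ∂(Measure.pi fun _ : Fin 7 => dx) ∂κ
        = ∫⁻ k : ↥(glInt 3 F), ∫⁻ r : Fin 7 → F,
            V.indicator h (Adg (((g⁻¹ : GL (Fin 3) F) : Matrix (Fin 3) (Fin 3) F) *
              (((k : GL (Fin 3) F) : Matrix (Fin 3) (Fin 3) F) * !![r 0, r 1, r 2; r 3, r 4, r 5; 0, 0, r 6] *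
                ((((k : GL (Fin 3) F))⁻¹ : GL (Fin 3) F) : Matrix (Fin 3) (Fin 3) F)) * (g : Matrix (Fin 3) (Fin 3) F))) ∂(Measure.pi fun _ : Fin 7 => dx) ∂κ := by
          refine lintegral_congr fun k => lintegral_congr fun r => ?_
          exact hL _
      _ = ∫⁻ k : ↥(glInt 3 F), ∫⁻ r : Fin 7 → F,
            V.indicator h (Adg (((k : GL (Fin 3) F) : Matrix (Fin 3) (Fin 3) F) * !![r 0, r 1, r 2; r 3, r 4, r 5; 0, 0, r 6] *
                ((((k : GL (Fin 3) F))⁻¹ : GL (Fin 3) F) : Matrix (Fin 3) (Fin 3) F))) ∂(Measure.pi fun _ : Fin 7 => dx) ∂κ := hA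
      _ = ∫⁻ k : ↥(glInt 3 F), ∫⁻ r : Fin 7 → F,
            B.indicator (fun Z => h (Adg Z)) (((k : GL (Fin 3) F) : Matrix (Fin 3) (Fin 3) F) * !![r 0, r 1, r 2; r 3, r 4, r 5; 0, 0, r 6] *
                ((((k : GL (Fin 3) F))⁻¹ : GL (Fin 3) F) : Matrix (Fin 3) (Fin 3) F)) ∂(Measure.pi fun _ : Fin 7 => dx) ∂κ := by
          refine lintegral_congr fun k => lintegral_congr fun r => hφ _
      _ = e * ∫⁻ Z in B, h (Adg Z) ∂μ𝔤 := hloc J (le_max_left _ _) _ hmeas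
      _ = e * ∫⁻ X in V, h X ∂μ𝔤 := by
          congr 1
          rw [← lintegral_indicator hBopen.measurableSet, ← lintegral_indicator (hBopen.preimage hci).measurableSet]
          simp only [← hφ]
          exact K2E3GL3LieAdInvariant.lintegral_comp_conj_eq μ𝔤 g (V.indicator h)

end Summit.HodgeConjecture.HodgeConjecture.Cruxes.H413.K2E3GL3ParabolicSliceLocalDensityTransport

end
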